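import Literature.Geometry.Lorentzian.SchoenYauMinimizingSurface
import Literature.Geometry.Lorentzian.PositiveMassSchoenYauReduction
import HarnessLib

/-!
# Schoen–Yau 1979, Theorem 1: what remains after Step 1, (2.13) and (2.16)–(2.18)

`PositiveMassSchoenYauReduction.lean` reduces the positive mass theorem `schoenYau_mass_nonneg`
(Schoen–Yau, Comm. Math. Phys. 65 (1979), Thm. 1) to Steps 2–3 of its printed proof, the
written-out hypothesis `h₂₃`. Step 3 is now formalised up to its two geometric inputs: the whole
passage (2.10)–(2.18) (`SchoenYauLogCutoff.lean`, `SchoenYauStableSurface.lean`,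
`SchoenYauStepThreeEnd.lean`), and the stability inequality (2.13) for area-minimising embedded
surfaces (`SecondVariationGram/Area.lean`, `StabilityOfMinimizers(Flow).lean`,
`SchoenYauMinimizingSurface.lean`). This file records the resulting reduction of `h₂₃` — hence of
Theorem 1 — to the two statements that remain to be formalised, both written out as hypotheses
(no named fact is introduced):

* **Step 2** (pp. 49–52, with (2.9) of p. 52): on one-ended asymptotically Schwarzschildean data
  with `R ≥ 0`, `R > 0` far out and `M < 0`, there is a complete (proper), non-compact, smoothly
  embedded minimal surface `S`, area-minimising on compact sets under compactly supported
  deformations (`SurfaceVariation.IsAreaMinimizingOn`), with quadratic area growth (2.9)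
  (geometric measure theory: Plateau solutions `S_σ`, the height bound (2.5), curvature estimates,
  and a limit);
* **the Claim** (p. 55, proved on pp. 55–63): such a surface has `∫_S K ≤ 0` (Cohn-Vossen /
  Huber–Finn, or Gauss–Bonnet with boundary).

* `SchoenYau.false_of_minimizing_surface_of_integral_gauss_nonpos` — **the contradiction of
  Step 3**: for data as in `h₂₃` (with `R > 0` on a far region) a surface as in Step 2 with
  `∫_S K ≤ 0` cannot exist: by `curvature_integrals_of_minimizing_minimal_end`,
  `0 < ½ ∫ (R + ‖A‖²) ≤ ∫ K ≤ 0`, the strict inequality because the non-compact, proper `S`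
  reaches the far region where `R > 0` (an open non-empty subset of `S`, of positive area).
* `SchoenYau.schoenYau_mass_nonneg_of_step2_of_claim` — **Theorem 1 from Step 2 and the Claim**
  (via `schoenYau_mass_nonneg_of_steps23`).
* `SchoenYau.schoenYau_mass_nonneg_of_minimizing_surface` — **Theorem 1 from ONE hypothesis**,
  Step 2 with the Claim folded into its output (the existence, for `M < 0`, of the surface of
  Step 2 together with `∫_S K ≤ 0`). Both printed proofs of the Claim (pp. 55–63) use the
  least-area property of `S` against cut-and-paste competitors (first proof, p. 57; second proof,
  (2.28)) and the topology of `S` (Remark 2.1, `S ≅ ℝ²`), i.e. more than the deformation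
  minimality `IsAreaMinimizingOn` recorded in the output of `step2`; a geometric-measure-theory
  construction of `S` delivers both at once, and this is the form to aim at.

Everything is proved; no definitions, no named facts.

## References

* R. Schoen, S.-T. Yau, *On the proof of the positive mass conjecture in general relativity*,
  Comm. Math. Phys. 65 (1979) 45–76, Thm. 1 (p. 48), §2, Step 2 (pp. 49–52), Step 3 (pp. 52–63),
  (2.9), (2.13), (2.16)–(2.18), the Claim (p. 55). [SchoenYauPMT1979]
-/

noncomputable section

open Bundle Set Filter Function Manifold MeasureTheory Module
open scoped Manifold ContDiff Topology

namespace Literature.Geometry.Lorentzian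

namespace SchoenYau

open PseudoRiemannianMetric

variable {X : Type} [TopologicalSpace X] [ChartedSpace E3 X] [IsManifold (𝓡 3) ∞ X]
  [T2Space X] [SecondCountableTopology X]
  (D : InitialDataSet (𝓡 3) X) [D.metric.HasLeviCivita] (e : AFEnd X)
  {S : Type} [TopologicalSpace S] [ChartedSpace (EuclideanSpace ℝ (Fin 2)) S]
  [IsManifold (𝓡 2) ∞ S] [T3Space S] [SecondCountableTopology S] [MeasurableSpace S]
  [BorelSpace S]

/-- **The contradiction of Schoen–Yau's Step 3.** Let `D` be one-ended asymptotically
Schwarzschildean data of mass `M` ((1.1), to second order) with `R ≥ 0` everywhere and `R > 0` on a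
far region `e.far ρ`. Then there is NO non-compact surface `S` with a proper smooth embedding
`f : S → X` which is minimal (smooth unit normal, `H = 0`), has quadratic area growth (2.9), is
area-minimising on every compact set under compactly supported deformations, and has
`∫_S K dμ ≤ 0` (`K = S_{f^*h}/2` the Gauss curvature): by (2.16)–(2.18)
(`curvature_integrals_of_minimizing_minimal_end`) `½ ∫ (R + ‖A‖²) ≤ ∫ K ≤ 0`, while the left side
is positive because `f⁻¹(far ρ)` — non-empty, as `S` is non-compact and `f⁻¹((far ρ)ᶜ)` is compact
— is an open set of positive area on which `R ∘ f > 0`. Schoen–Yau 1979, p. 55: "(2.18) …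
`0 < ½ ∫ (R + Σ h²ᵢⱼ) ≤ ∫ K` … we show that `∫_S K ≤ 0` … This contradiction then establishes
Theorem 1." [cite: SchoenYauPMT1979, §2, Step 3, p. 55, (2.18) and the Claim] -/
theorem false_of_minimizing_surface_of_integral_gauss_nonpos [NoncompactSpace S] {M : ℝ}
    (hAS : IsAsymptoticallySchwarzschild e D M 2) (hsole : e.IsSoleEnd)
    (hR0 : ∀ x : X, 0 ≤ D.metric.scalarCurvature x)
    {ρ : ℝ} (hRpos : ∀ x ∈ e.far ρ, 0 < D.metric.scalarCurvature x)
    {f : S → X} (hpb : contMDiff_pullbackBilin (𝓡 3) X (𝓡 2) S ∞)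
    (hemb : IsSmoothEmbedding (𝓡 2) (𝓡 3) ∞ f)
    (hfi : D.metric.IsSpacelikeImmersion (𝓡 2) f)
    (hprop : ∀ K : Set X, IsCompact K → IsCompact (f ⁻¹' K))
    {ν : NormalField (𝓡 3) f}
    (hν : ContMDiff (𝓡 2) (𝓡 3).tangent ∞
      (fun x ↦ (TotalSpace.mk' E3 (f x) (ν x) : TangentBundle (𝓡 3) X)))
    (hun : D.metric.IsUnitNormal (𝓡 2) f ν 1) (hmin : D.metric.IsMaximalSlice f hpb hfi ν)
    (hgrowth : ∃ C : ℝ, ∀ t : ℝ, 1 ≤ t →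
      riemannianMeasure (D.metric.inducedRiemannianMetric f hpb hfi) (f ⁻¹' (e.far t)ᶜ) ≤
        ENNReal.ofReal (C * t ^ 2))
    (harea : ∀ K : Set S, IsCompact K → SurfaceVariation.IsAreaMinimizingOn (h := D.h) hpb f K)
    (hclaim : haveI := (D.metric.inducedMetric f hpb hfi).hasLeviCivita
      ∫ y, (D.metric.inducedMetric f hpb hfi).scalarCurvature y / 2
        ∂(riemannianMeasure (D.metric.inducedRiemannianMetric f hpb hfi)) ≤ 0) :
    False := by
  haveI := (D.metric.inducedMetric f hpb hfi).hasLeviCivita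
  obtain ⟨-, -, -, hle, hpos⟩ := curvature_integrals_of_minimizing_minimal_end D e hAS hsole hR0
    hpb hemb hfi hprop hν hun hmin hgrowth harea
  set μ := riemannianMeasure (D.metric.inducedRiemannianMetric f hpb hfi) with hμ
  -- `f⁻¹(far ρ)` is a non-empty open subset of `S` of positive area, on which `R ∘ f > 0`
  have hopen : IsOpen (f ⁻¹' e.far ρ) := (e.isOpen_far ρ).preimage hemb.isEmbedding.continuous
  have hne : (f ⁻¹' e.far ρ).Nonempty := by
    by_contra hempty
    rw [not_nonempty_iff_eq_empty] at hempty
    have hcpt : IsCompact (f ⁻¹' (e.far ρ)ᶜ) := hprop _ (AFEnd.isCompact_compl_far hsole ρ)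
    have huniv : f ⁻¹' (e.far ρ)ᶜ = univ := by
      rw [preimage_compl, hempty, compl_empty]
    rw [huniv] at hcpt
    exact noncompact_univ S hcpt
  haveI := isOpenPosMeasure_riemannianMeasure (D.metric.inducedRiemannianMetric f hpb hfi)
  have hμpos : μ (f ⁻¹' e.far ρ) ≠ 0 := (hopen.measure_pos μ hne).ne'
  have hsub : f ⁻¹' e.far ρ ⊆ {y | 0 < D.metric.scalarCurvature (f y)} := fun y hy ↦ hRpos _ hy
  have hμpos' : μ {y | 0 < D.metric.scalarCurvature (f y)} ≠ 0 := fun h0 ↦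
    hμpos (measure_mono_null hsub h0)
  have h1 := hpos hμpos'
  linarith

/-- **Schoen–Yau's Theorem 1 from Step 2 and the Claim.** The positive mass theorem
`schoenYau_mass_nonneg` (Comm. Math. Phys. 65 (1979), Thm. 1) follows from the two remaining
inputs of its printed proof, written out as hypotheses: **Step 2** (pp. 49–52 with (2.9)): on
connected, oriented, one-ended asymptotically Schwarzschildean data with `R ≥ 0`, `R > 0` on a far
region and `M < 0` there is a non-compact surface `S` (charted on `ℝ²`) with a proper smooth
embedding `f : S → X`, minimal with smooth unit normal, of quadratic area growth (2.9), and
area-minimising on compact sets under compactly supported smooth deformations; and **the Claim**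
(p. 55): every such surface has `∫_S K ≤ 0`. Step 1 (`exists_conformal_scalarPos_of_massNeg_holds`),
(2.10)–(2.18) and (2.13) being theorems, `schoenYau_mass_nonneg_of_steps23` and
`false_of_minimizing_surface_of_integral_gauss_nonpos` conclude.
[cite: SchoenYauPMT1979, Thm. 1 (p. 48), §2 Steps 2–3] -/
theorem schoenYau_mass_nonneg_of_step2_of_claim
    (step2 : ∀ (X : Type) [TopologicalSpace X] [ChartedSpace E3 X] [IsManifold (𝓡 3) ∞ X]
      [T2Space X] [SecondCountableTopology X] [ConnectedSpace X]
      (D : InitialDataSet (𝓡 3) X) [D.metric.HasLeviCivita] (e : AFEnd X) (M : ℝ),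
      Literature.Topology.FourManifolds.IsOrientable (𝓡 3) X →
      IsAsymptoticallySchwarzschild e D M 2 → e.IsSoleEnd →
      (∀ x : X, 0 ≤ D.metric.scalarCurvature x) →
      (∃ ρ : ℝ, ∀ x ∈ e.far ρ, 0 < D.metric.scalarCurvature x) → M < 0 →
      ∃ (S : Type) (_ : TopologicalSpace S) (_ : ChartedSpace (EuclideanSpace ℝ (Fin 2)) S)
        (_ : IsManifold (𝓡 2) ∞ S) (_ : T3Space S) (_ : SecondCountableTopology S)
        (_ : MeasurableSpace S) (_ : BorelSpace S) (_ : NoncompactSpace S)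
        (f : S → X) (hpb : contMDiff_pullbackBilin (𝓡 3) X (𝓡 2) S ∞)
        (hfi : D.metric.IsSpacelikeImmersion (𝓡 2) f) (ν : NormalField (𝓡 3) f),
        IsSmoothEmbedding (𝓡 2) (𝓡 3) ∞ f ∧
        (∀ K : Set X, IsCompact K → IsCompact (f ⁻¹' K)) ∧
        ContMDiff (𝓡 2) (𝓡 3).tangent ∞
          (fun x ↦ (TotalSpace.mk' E3 (f x) (ν x) : TangentBundle (𝓡 3) X)) ∧
        D.metric.IsUnitNormal (𝓡 2) f ν 1 ∧ D.metric.IsMaximalSlice f hpb hfi ν ∧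
        (∃ C : ℝ, ∀ t : ℝ, 1 ≤ t →
          riemannianMeasure (D.metric.inducedRiemannianMetric f hpb hfi) (f ⁻¹' (e.far t)ᶜ) ≤
            ENNReal.ofReal (C * t ^ 2)) ∧
        (∀ K : Set S, IsCompact K → SurfaceVariation.IsAreaMinimizingOn (h := D.h) hpb f K))
    (claim : ∀ (X : Type) [TopologicalSpace X] [ChartedSpace E3 X] [IsManifold (𝓡 3) ∞ X]
      [T2Space X] [SecondCountableTopology X] [ConnectedSpace X]
      (D : InitialDataSet (𝓡 3) X) [D.metric.HasLeviCivita] (e : AFEnd X) (M : ℝ),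
      IsAsymptoticallySchwarzschild e D M 2 → e.IsSoleEnd →
      ∀ (S : Type) [TopologicalSpace S] [ChartedSpace (EuclideanSpace ℝ (Fin 2)) S]
        [IsManifold (𝓡 2) ∞ S] [T3Space S] [SecondCountableTopology S]
        [MeasurableSpace S] [BorelSpace S] [NoncompactSpace S]
        (f : S → X) (hpb : contMDiff_pullbackBilin (𝓡 3) X (𝓡 2) S ∞)
        (hfi : D.metric.IsSpacelikeImmersion (𝓡 2) f) (ν : NormalField (𝓡 3) f),
        IsSmoothEmbedding (𝓡 2) (𝓡 3) ∞ f →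
        (∀ K : Set X, IsCompact K → IsCompact (f ⁻¹' K)) →
        ContMDiff (𝓡 2) (𝓡 3).tangent ∞
          (fun x ↦ (TotalSpace.mk' E3 (f x) (ν x) : TangentBundle (𝓡 3) X)) →
        D.metric.IsUnitNormal (𝓡 2) f ν 1 → D.metric.IsMaximalSlice f hpb hfi ν →
        (∃ C : ℝ, ∀ t : ℝ, 1 ≤ t →
          riemannianMeasure (D.metric.inducedRiemannianMetric f hpb hfi) (f ⁻¹' (e.far t)ᶜ) ≤
            ENNReal.ofReal (C * t ^ 2)) →
        (∀ K : Set S, IsCompact K → SurfaceVariation.IsAreaMinimizingOn (h := D.h) hpb f K) →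
        haveI := (D.metric.inducedMetric f hpb hfi).hasLeviCivita
        ∫ y, (D.metric.inducedMetric f hpb hfi).scalarCurvature y / 2
          ∂(riemannianMeasure (D.metric.inducedRiemannianMetric f hpb hfi)) ≤ 0) :
    schoenYau_mass_nonneg := by
  refine schoenYau_mass_nonneg_of_steps23 ?_
  intro X _ _ _ _ _ _ D _ e M hor hAS hsole hR0 hRfar
  by_contra hM
  push Not at hM
  obtain ⟨ρ, hRpos⟩ := hRfar
  obtain ⟨S, _, _, _, _, _, _, _, _, f, hpb, hfi, ν, hemb, hprop, hν, hun, hmin, hgrowth, harea⟩ :=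
    step2 X D e M hor hAS hsole hR0 ⟨ρ, hRpos⟩ hM
  exact false_of_minimizing_surface_of_integral_gauss_nonpos D e hAS hsole hR0 hRpos hpb hemb hfi
    hprop hν hun hmin hgrowth harea
    (claim X D e M hAS hsole S f hpb hfi ν hemb hprop hν hun hmin hgrowth harea)

/-- **Schoen–Yau's Theorem 1 from a single hypothesis: Step 2 together with the Claim.** If for
all one-ended asymptotically Schwarzschildean data with `R ≥ 0`, `R > 0` far out and `M < 0` there
is a non-compact surface `S`, properly and smoothly embedded, minimal with a smooth unit normal,
of quadratic area growth (2.9), area-minimising on compact sets under compactly supported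
deformations, AND with `∫_S K dμ ≤ 0` (Schoen–Yau 1979, §2: Step 2, pp. 49–52, and the Claim,
pp. 55–63 — both obtained in the paper from the least-area construction of `S`), then
`schoenYau_mass_nonneg` holds: Step 1 is the tree's `exists_conformal_scalarPos_of_massNeg_holds`
and Step 3 is `false_of_minimizing_surface_of_integral_gauss_nonpos`.
[cite: SchoenYauPMT1979, Thm. 1 (p. 48); §2 Step 2 (pp. 49–52) and Claim (pp. 55–63)] -/
theorem schoenYau_mass_nonneg_of_minimizing_surface
    (step23 : ∀ (X : Type) [TopologicalSpace X] [ChartedSpace E3 X] [IsManifold (𝓡 3) ∞ X]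
      [T2Space X] [SecondCountableTopology X] [ConnectedSpace X]
      (D : InitialDataSet (𝓡 3) X) [D.metric.HasLeviCivita] (e : AFEnd X) (M : ℝ),
      Literature.Topology.FourManifolds.IsOrientable (𝓡 3) X →
      IsAsymptoticallySchwarzschild e D M 2 → e.IsSoleEnd →
      (∀ x : X, 0 ≤ D.metric.scalarCurvature x) →
      (∃ ρ : ℝ, ∀ x ∈ e.far ρ, 0 < D.metric.scalarCurvature x) → M < 0 →
      ∃ (S : Type) (_ : TopologicalSpace S) (_ : ChartedSpace (EuclideanSpace ℝ (Fin 2)) S)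
        (_ : IsManifold (𝓡 2) ∞ S) (_ : T3Space S) (_ : SecondCountableTopology S)
        (_ : MeasurableSpace S) (_ : BorelSpace S) (_ : NoncompactSpace S)
        (f : S → X) (hpb : contMDiff_pullbackBilin (𝓡 3) X (𝓡 2) S ∞)
        (hfi : D.metric.IsSpacelikeImmersion (𝓡 2) f) (ν : NormalField (𝓡 3) f),
        IsSmoothEmbedding (𝓡 2) (𝓡 3) ∞ f ∧
        (∀ K : Set X, IsCompact K → IsCompact (f ⁻¹' K)) ∧
        ContMDiff (𝓡 2) (𝓡 3).tangent ∞
          (fun x ↦ (TotalSpace.mk' E3 (f x) (ν x) : TangentBundle (𝓡 3) X)) ∧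
        D.metric.IsUnitNormal (𝓡 2) f ν 1 ∧ D.metric.IsMaximalSlice f hpb hfi ν ∧
        (∃ C : ℝ, ∀ t : ℝ, 1 ≤ t →
          riemannianMeasure (D.metric.inducedRiemannianMetric f hpb hfi) (f ⁻¹' (e.far t)ᶜ) ≤
            ENNReal.ofReal (C * t ^ 2)) ∧
        (∀ K : Set S, IsCompact K → SurfaceVariation.IsAreaMinimizingOn (h := D.h) hpb f K) ∧
        (haveI := (D.metric.inducedMetric f hpb hfi).hasLeviCivita
          ∫ y, (D.metric.inducedMetric f hpb hfi).scalarCurvature y / 2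
            ∂(riemannianMeasure (D.metric.inducedRiemannianMetric f hpb hfi)) ≤ 0)) :
    schoenYau_mass_nonneg := by
  refine schoenYau_mass_nonneg_of_steps23 ?_
  intro X _ _ _ _ _ _ D _ e M hor hAS hsole hR0 hRfar
  by_contra hM
  push Not at hM
  obtain ⟨ρ, hRpos⟩ := hRfar
  obtain ⟨S, _, _, _, _, _, _, _, _, f, hpb, hfi, ν, hemb, hprop, hν, hun, hmin, hgrowth, harea,
      hclaim⟩ := step23 X D e M hor hAS hsole hR0 ⟨ρ, hRpos⟩ hM
  exact false_of_minimizing_surface_of_integral_gauss_nonpos D e hAS hsole hR0 hRpos hpb hemb hfi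
    hprop hν hun hmin hgrowth harea hclaim

end SchoenYau

end Literature.Geometry.Lorentzian

end
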